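import Mathlib
import Literature.Barriers.AtomisticToContinuum.LocalizedPotentialsExcludeLennardJones
import HarnessLib

/-!
# Flatley–Theil (2015): face-centred cubic crystallization of atomistic configurations
(Theorem 1.1, the main theorem)

Named fact (Literature is sorry-free; users take `(h : FlatleyTheil2015_thm11)` — but see the
**Discrepancy record** below: the transcribed fact is REFUTED in the tree, the printed theorem is
vacuous), stated over the tree's transcription of Flatley–Theil's potential class —
`FlatleyTheil2015.IsLocalizedPair α V`, `FlatleyTheil2015.IsLocalizedTriple α Ψ`
(Definition 2.1, items 1–2), the fcc lattice
`fccPoint : ℤ³ →+ ℝ³` / `fccLattice` and the pair lattice sum `fccLatticeSum V r` — which live in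
`Literature/Barriers/AtomisticToContinuum/LocalizedPotentialsExcludeLennardJones.lean` (whose
docstring asks for exactly this litbuild: "The energy `E(Y)`, `E_fcc(r)` and Theorem 1.1 itself
are not restated (a `litbuild` of `FlatleyTheil2015` should …)"). This file adds the two energies
and the theorem; the definitions of the class are imported, not duplicated.

Source: L. Flatley, F. Theil, *Face-centered cubic crystallization of atomistic configurations*,
Arch. Ration. Mech. Anal. **218** (2015) 363–416 = arXiv:1407.0692 [cite: FlatleyTheil2015],
read on the held arXiv text pp. 2–8:

* §2 eq. (2.1) (p. 7, "(potrep)"): the invariances (1.1) give `V : [0,∞) → ℝ`,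
  `Ψ : [0,∞)³ → ℝ` with `V₂(y₁,y₂) = V(|y₂ - y₁|)` and
  `V₃(y₁,y₂,y₃) = Ψ(|y₂ - y₁|, |y₃ - y₂|, |y₁ - y₃|)`; Definition 2.1 (p. 7): `(V₂,V₃)` is
  `α`-localized iff `(V, Ψ) ∈ Y_α` (tree: `IsLocalizedPair α V ∧ IsLocalizedTriple α Ψ`).
* **Theorem 1.1 (Main theorem)** (p. 4, verbatim): *There exists `α₀ > 0` such that for any
  `α ∈ (0, α₀)` and any pair of `α`-localized potentials `(V₂,V₃)` which is invariant under
  translations and rotations in the sense that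
  `Vᵢ(Rξ_{π(1)} + t, …, Rξ_{π(i)} + t) = Vᵢ(ξ₁, …, ξᵢ)` for all permutations `π`, `R ∈ O(3)`,
  `t ∈ ℝ³`, `i ∈ {2,3}` (1.1), and any finite set `Y ⊂ ℝ³` the inequality
  `(1/#Y) E(Y) > min_{r>0} E_fcc(r)` (1.2) holds, where
  `E(Y) = 2 ∑_{{y,y'} ⊂ Y} V₂(y,y') + 6 ∑_{{y,y',y''} ⊂ Y} V₃(y,y',y'')` (1.3) and
  `E_fcc(r) = ∑_{y ∈ L_fcc∖{0}} V₂(0, r y) + 2 ∑_{{y,y'} ⊂ L_fcc∖{0}} V₃(0, r y, r y')`.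
  Moreover `lim_{R→∞} (1/#Y_R) E(Y_R) = min_{r>0} E_fcc(r)` (1.4) if `Y_R = B(0,R) ∩ L_fcc`.*
  (p. 4: "Note that we later assume that `min_{r>0} E_fcc(r) = E_fcc(1)`. This assumption does
  not involve any loss of generality as it can be achieved by rescaling the potentials.")

Rendering:
* for potentials of the form (2.1), rotation and translation invariance in (1.1) are automatic;
  the remaining content of (1.1), permutation invariance of `V₃`, is kept as the explicit
  hypothesis that `Ψ ∘ sideLengths` is invariant under permuting the three points (stated for all
  triples — a slightly stronger hypothesis, hence a weaker fact);
* `E(Y)` is written as sums over ORDERED pairs / triples of distinct points of a `Finset`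
  (`= 2 ∑_{pairs} + 6 ∑_{triples}` by that symmetry): `configEnergy`; `E_fcc(r)` as the tree's
  pair lattice sum plus the `tsum` over ordered pairs of distinct non-zero lattice labels of
  `V₃(0, r k, r k')` (`= 2 ∑_{{k,k'}}`; finitely supported for `r > 0` since `Ψ = 0` once a side
  is `≥ 7/5`, so the `tsum` carries no junk): `fccEnergy`;
* (1.2) "`E(Y)/#Y > min_{r>0} E_fcc(r)`" is rendered junk-free as
  `∃ r > 0, E_fcc(r) < E(Y)/#Y` for non-empty finite `Y` (implied by the printed strict
  inequality at the minimiser; `Y = ∅` is dropped);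
* (1.4) `lim_{R→∞} E(Y_R)/#Y_R = min_{r>0} E_fcc(r)`, `Y_R = B(0,R) ∩ L_fcc` (open ball; the
  limit is insensitive to the choice), is rendered junk-free and without a finiteness proof by
  quantifying over the `Finset`s `Y` with `↑Y = B(0,R) ∩ L_fcc`: for every `ε > 0`, for all large
  `R`, such `Y` is non-empty and `E(Y)/#Y < E_fcc(r) + ε` for every `r > 0` (`< min + ε` ⇔
  `∀ r, < E_fcc(r) + ε`); this is the upper half of the limit, the lower half being (1.2) = (i);
  no normalisation `min_r E_fcc(r) = E_fcc(1)` is assumed (that is only the paper's later WLOG);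
* `∃ α₀` outermost, as printed (one `α₀` for all potentials in the class).

Not vendored: Corollary 1.3 (periodic / clamped boundary conditions, positional crystallization
`R Z + t = L_fcc`) and Conjecture 2.2 (already the crux `TwoCentreFourCommon` of route
TwoCentreKissingKernel).

Bears on the Crystallization cruxes of `AtomisticToContinuum` that cite [FlatleyTheil2015] as the
only proved 3-D crystallization theorem for smooth potentials —
`Summit.AtomisticToContinuum.Crystallization.Theses.BrittleRungDescent.BrittleBarlowRigidity`
(stmt-AtomisticToContinuum-10942), `…Theses.HullMinimality.LayeredWindows` (stmt-11778),
`…Theses.FlatToriSuffice.DefectGapAtMinimiser` (stmt-11951), `…Theses.OneCrossingRisingSea.ClassOnePositional`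
(stmt-12048), `…Theses.HcpDefectCoercivity.HcpDefectCoercivity` (stmt-14476) — as a hypothesis
(fcc energetic crystallization in the `Y_α` class; those items go beyond it: Barlow stackings,
pure pair potentials, positional statements).

**Discrepancy record (2026-08-15, section `PrintedClassEmpty` at the end of this file).**
`FlatleyTheil2015_thm11` is NOT the printed theorem: `IsLocalizedPair` reads `V''` as
`deriv^[2] V` without requiring `V'` to be differentiable on the ranges of (2.7)–(2.8), so its
hypothesis class is strictly larger than the paper's `Y_α` (the fact is stronger than the source)
— and it is FALSE: **refuted 2026-08-25 by
`FlatleyTheil2015.FlatleyTheil2015_thm11_false : ¬ FlatleyTheil2015_thm11`** in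
`Literature/MathematicalPhysics/StatisticalMechanics/FlatleyTheil2015TranscribedRefutation.lean`
(which imports this file, so the refutation cannot be restated here): clause (i) fails for a `C¹`
potential of the transcribed class whose derivative is a singular (Cantor-type) function beyond
`1 + α`, carrying a second well at the non-fcc distance `27/20` (`TranscribedExample.Vp`, `Psi`;
the transcribed class is non-empty, `TranscribedExample.isLocalizedPair_Vp`). And the printed class
itself is EMPTY for `α ≤ 1/4` (`not_isLocalizedPair_of_differentiableOn`), so Theorem 1.1 as printed
(`FlatleyTheil2015_thm11_printed`) holds only vacuously. Do not cite either as a usable 3-D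
crystallization theorem; no repaired (non-vacuous, true) form of Theorem 1.1 is stated in any
source we can cite (see section `PrintedClassEmpty`), so none is vendored.
-/

noncomputable section

open scoped BigOperators
open Literature.Barriers.AtomisticToContinuum.FlatleyTheil2015

namespace Literature.MathematicalPhysics.StatisticalMechanics.FlatleyTheil2015

/-- The side-length triple `(|y₂ - y₁|, |y₃ - y₂|, |y₁ - y₃|)` of an ordered triangle, the
argument of `Ψ` in `V₃(y₁,y₂,y₃) = Ψ(|y₂ - y₁|, |y₃ - y₂|, |y₁ - y₃|)`.
[cite: FlatleyTheil2015, §2 eq. (2.1)] -/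
def sideLengths (y₁ y₂ y₃ : Space) : Fin 3 → ℝ :=
  ![‖y₂ - y₁‖, ‖y₃ - y₂‖, ‖y₁ - y₃‖]

open Classical in
/-- The configurational energy `E(Y) = 2 ∑_{{y,y'} ⊂ Y} V(|y' - y|) +
6 ∑_{{y,y',y''} ⊂ Y} Ψ(side lengths)` of a finite configuration `Y ⊂ ℝ³`, written as sums over
ordered pairs and ordered triples of distinct points (each unordered pair, resp. triple, is counted
`2`, resp. `6` times; for permutation-invariant `V₃` this is (1.3)).
[cite: FlatleyTheil2015, §1 Theorem 1.1 eq. (1.3)] -/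
def configEnergy (V : ℝ → ℝ) (Ψ : (Fin 3 → ℝ) → ℝ) (Y : Finset Space) : ℝ :=
  (∑ y ∈ Y, ∑ y' ∈ Y.erase y, V ‖y' - y‖) +
    ∑ y ∈ Y, ∑ y' ∈ Y.erase y, ∑ y'' ∈ (Y.erase y).erase y', Ψ (sideLengths y y' y'')

/-- The renormalised energy `E_fcc(r) = ∑_{k ∈ L_fcc∖{0}} V(r|k|) +
2 ∑_{{k,k'} ⊂ L_fcc∖{0}} V₃(0, r k, r k')` of the dilated lattice `r L_fcc`: the tree's pair
lattice sum `fccLatticeSum V r` plus the three-body lattice sum over ordered pairs of distinct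
non-zero labels (each unordered pair twice). [cite: FlatleyTheil2015, §1 Theorem 1.1 (definition of E_fcc)] -/
def fccEnergy (V : ℝ → ℝ) (Ψ : (Fin 3 → ℝ) → ℝ) (r : ℝ) : ℝ :=
  fccLatticeSum V r +
    ∑' p : {p : (Fin 3 → ℤ) × (Fin 3 → ℤ) // p.1 ≠ 0 ∧ p.2 ≠ 0 ∧ p.1 ≠ p.2},
      Ψ (sideLengths 0 (r • fccPoint p.1.1) (r • fccPoint p.1.2))

/-- **Flatley–Theil 2015, Theorem 1.1 (fcc crystallization, energy form).** There is `α₀ > 0`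
such that for every `α ∈ (0, α₀)`, every `α`-localized pair `(V, Ψ) ∈ Y_α`
(`IsLocalizedPair α V`, `IsLocalizedTriple α Ψ`) whose three-body term
`V₃ = Ψ(|y₂-y₁|, |y₃-y₂|, |y₁-y₃|)` is invariant under permutations of the three points:
(i) every non-empty finite configuration `Y ⊂ ℝ³` has energy per particle STRICTLY above the
dilated-fcc value for some dilation, `∃ r > 0, E_fcc(r) < E(Y)/#Y` (printed:
`E(Y)/#Y > min_{r>0} E_fcc(r)`); (ii) the balls of the lattice are asymptotically optimal: for every
`ε > 0` and all large `R`, the finite set `Y_R = B(0,R) ∩ L_fcc` is non-empty and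
`E(Y_R)/#Y_R < E_fcc(r) + ε` for every dilation `r > 0` (printed as the limit
`lim_{R→∞} E(Y_R)/#Y_R = min_{r>0} E_fcc(r)`, eq. (1.4): its upper half is this clause, its
lower half is (i)).
**WARNING — FALSE AS TRANSCRIBED; do not feed to routes.** This `Prop` is REFUTED in the tree:
`FlatleyTheil2015.FlatleyTheil2015_thm11_false : ¬ FlatleyTheil2015_thm11`
(`FlatleyTheil2015TranscribedRefutation.lean`, 2026-08-25) — clause (i) fails inside the
transcribed class `IsLocalizedPair`/`IsLocalizedTriple`, which (reading `V''` as the junk-valued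
`deriv (deriv V)`) is strictly larger than the paper's `Y_α`; so a hypothesis
`(h : FlatleyTheil2015_thm11)` is equivalent to `False`. The statement with the paper's `V''` genuinely existing is the THEOREM
`FlatleyTheil2015_thm11_printed` below, which holds only vacuously (the printed class is empty
for `α ≤ 1/4`, `not_isLocalizedPair_of_differentiableOn`). Neither is a usable 3-D
crystallization theorem; see the module docstring («Discrepancy record») and section
`PrintedClassEmpty`. The transcription is kept verbatim (append-only file; it is the statement
the refutation names).
[cite: FlatleyTheil2015, Thm 1.1 (arXiv p. 4) with §2 eq. (2.1) and Definition 2.1 (p. 7)] -/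
def FlatleyTheil2015_thm11 : Prop :=
  ∃ α₀ : ℝ, 0 < α₀ ∧ ∀ α : ℝ, 0 < α → α < α₀ →
    ∀ (V : ℝ → ℝ) (Ψ : (Fin 3 → ℝ) → ℝ), IsLocalizedPair α V → IsLocalizedTriple α Ψ →
      (∀ (y : Fin 3 → Space) (σ : Equiv.Perm (Fin 3)),
          Ψ (sideLengths (y (σ 0)) (y (σ 1)) (y (σ 2))) = Ψ (sideLengths (y 0) (y 1) (y 2))) →
      (∀ Y : Finset Space, Y.Nonempty →
          ∃ r : ℝ, 0 < r ∧ fccEnergy V Ψ r < configEnergy V Ψ Y / Y.card) ∧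
      (∀ ε : ℝ, 0 < ε → ∃ R₀ : ℝ, ∀ R : ℝ, R₀ ≤ R → ∀ Y : Finset Space,
          (↑Y : Set Space) = Metric.ball (0 : Space) R ∩ fccLattice →
            Y.Nonempty ∧ ∀ r : ℝ, 0 < r → configEnergy V Ψ Y / Y.card < fccEnergy V Ψ r + ε)

#harness_tags FlatleyTheil2015_thm11

/-! ## Definition 2.1 as printed is inconsistent; the printed Theorem 1.1 (with `V''` existing) holds vacuously

(literature-prover, 2026-08-15; read on the held arXiv v1 text = WRAP accepted manuscript of the
ARMA paper: Definition 2.1, printed p. 8, eqs. (2.2)–(2.8); Lemma 2.5, printed p. 10,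
eqs. (2.14)–(2.17); Theorem 1.1, printed p. 3.)

**The discrepancy.** Item 1 of Definition 2.1 constrains `V''` on three ranges: (2.5)
`V'' ≥ 1` on `(1-α, 1+α)`, (2.7) `|V''| ≤ α^{1/4}` on `[1+α, √(7/2)]`, (2.8) `|V''(r)| ≤ α r⁻¹⁰`
on `[√(7/2), ∞)`, for `V ∈ C¹([0,∞))`; writing `V''(r)` presupposes that `V'` is differentiable
there (the paper integrates these bounds: Lemma 2.5, "`|V'(r)| ≤ α^{1/4}`, `|V(r)| ≤ α^{1/4}` for
`r ∈ [1+α, √(7/2)]`, `|V(r)| ≤ α r⁻⁸` for `r ≥ √(7/2)` … follows immediately from assumptions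
(2.2)–(2.8)"). The tree's transcription `IsLocalizedPair` renders `V''` as `deriv^[2] V =
deriv (deriv V)` WITHOUT requiring `deriv V` to be differentiable: in (2.5) the inequality
`1 ≤ deriv (deriv V) r` forces differentiability (the junk value is `0`), but `medium` (2.7) and
`decay` (2.8) are satisfied by every `C¹` potential whose derivative is a singular function
(continuous, monotone pieces with `deriv (deriv V) = 0` identically) beyond `1 + α`. So the
hypothesis class of `FlatleyTheil2015_thm11` is much larger than the paper's `Y_α`, and that fact
asserts fcc crystallization for potentials [FlatleyTheil2015] never treats (its proof uses Lemma
2.5 throughout): it is stated STRONGER than the source. `FlatleyTheil2015_thm11_printed` below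
adds the two missing hypotheses — `deriv V` differentiable on the interiors `(1+α, √(7/2))` and
`(√(7/2), ∞)` of the ranges of (2.7) and (2.8) — and is otherwise verbatim the same statement.

**The consequence (proved here).** With `V''` existing, item 1 of Definition 2.1 is
inconsistent for every `0 < α ≤ 1/4` (`not_isLocalizedPair_of_differentiableOn`): by the
paper's own Lemma 2.5 mechanism ((2.14)–(2.16)), (2.8) and `V → 0` give `V'(√(7/2)) ≤ α/7`,
`V(√(7/2)) ≥ -α/2` (Step A), then (2.7) gives `V'(1+α) ≤ α/7 + α^{1/4}` and `V(1+α) ≥ -α/2 - α/7 - α^{1/4}/2`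
(Step B), while (2.5) makes `V'` monotone on `[1, 1+α]`, whence
`V(1+α) ≤ V(1) + α V'(1+α) = -1 + α V'(1+α)` (Step C); together `1 ≤ 19α/28 + (3/4) α^{1/4}`,
false for `α ≤ 1/4`. (In words: `V(1) = -1`, but Lemma 2.5 forces `V(1+α) ≈ 0` and
`V'(1+α) ≈ 0`, and a function convex on `(1-α, 1+α)` cannot climb by `1` over `[1, 1+α]` and
arrive with slope `≈ 0`. Theil's two-dimensional class [Theil2006, Thm 1.1 (3)–(5)] avoids this
because its `V''`-bound only starts at `4/3`.) Hence `Y_α = ∅` for `α ≤ 1/4` and Theorem 1.1 AS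
PRINTED holds vacuously with `α₀ = 1/4`: `FlatleyTheil2015_thm11_printed` (a theorem). No corrected
version of Definition 2.1 is published (arXiv 1407.0692 has a single version, identical to the
WRAP accepted manuscript of the ARMA paper); what the authors' 48-page argument establishes for a
repaired class (e.g. with (2.7) imposed only from `1 + √α`, say) is not stated anywhere we can cite,
so it is NOT vendored. The transcribed `FlatleyTheil2015_thm11` is left in place (append-only
file) but should not be used as "the proved 3-D crystallization theorem": it is not what the
paper proves, and it is in fact FALSE — potentials with singular `V'` can carry extra wells at
non-fcc distances while satisfying every transcribed field; this mechanism is now a kernel-checked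
refutation, `FlatleyTheil2015.FlatleyTheil2015_thm11_false : ¬ FlatleyTheil2015_thm11`
(`FlatleyTheil2015TranscribedRefutation.lean`, 2026-08-25; the example `TranscribedExample.Vp` is
`C¹` with `deriv (deriv Vp) = 0` on `[1 + α, ∞)`, has a second well of depth `1000` at `r = 27/20`
and a compensating plateau at `2 · 27/20`, so `E({0,p})/2 = -1000 < inf_r E_fcc(r)` for
`|p| = 27/20`).
That file imports this one, which is why the refutation is only referenced, not restated, here.
-/

section PrintedClassEmpty

open Set Filter
open scoped Topology

variable {α : ℝ} {V : ℝ → ℝ}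

/-- `5/4 ≤ √(7/2)` (`25/16 ≤ 7/2`). [folklore] -/
theorem five_fourths_le_sqrt_seven_halves : (5 / 4 : ℝ) ≤ √(7 / 2) :=
  Real.le_sqrt_of_sq_le (by norm_num)

/-- A `C¹([0,∞))` pair potential is differentiable at every `r > 0`. [folklore] -/
theorem hasDerivAt_of_isLocalizedPair (hV : IsLocalizedPair α V) {r : ℝ} (hr : 0 < r) :
    HasDerivAt V (deriv V r) r :=
  ((hV.contDiffOn.differentiableOn one_ne_zero).differentiableAt (Ici_mem_nhds hr)).hasDerivAt

/-- … its derivative is continuous on `(0, ∞)` … [folklore] -/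
theorem continuousOn_deriv_of_isLocalizedPair (hV : IsLocalizedPair α V) :
    ContinuousOn (deriv V) (Ioi 0) :=
  (hV.contDiffOn.mono Ioi_subset_Ici_self).continuousOn_deriv_of_isOpen isOpen_Ioi le_rfl

/-- … and it is continuous on `(0, ∞)`. [folklore] -/
theorem continuousOn_of_isLocalizedPair (hV : IsLocalizedPair α V) : ContinuousOn V (Ioi 0) :=
  (hV.contDiffOn.mono Ioi_subset_Ici_self).continuousOn

/-- Since `V → 0` at infinity, `V'` cannot stay above a positive constant on a half-line
(`V(s) ≥ V(r) + c (s - r)` would be unbounded). [folklore] -/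
theorem false_of_le_deriv_of_isLocalizedPair (hV : IsLocalizedPair α V) {r c : ℝ} (hr : 0 < r)
    (hc : 0 < c) (h : ∀ s, r ≤ s → c ≤ deriv V s) : False := by
  -- `s ↦ V s - c s` is monotone on `[r, ∞)`
  have hmono : MonotoneOn (fun s => V s - c * s) (Ici r) := by
    refine monotoneOn_of_hasDerivWithinAt_nonneg (convex_Ici r) (f' := fun s => deriv V s - c)
      ?_ ?_ ?_
    · exact ((continuousOn_of_isLocalizedPair hV).mono fun s hs => hr.trans_le hs).sub
        (Continuous.continuousOn (by fun_prop))
    · intro s hs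
      rw [interior_Ici] at hs ⊢
      have h1 := hasDerivAt_of_isLocalizedPair hV (hr.trans (mem_Ioi.mp hs))
      have h2 : HasDerivAt (fun y : ℝ => c * y) c s := by
        simpa using (hasDerivAt_id s).const_mul c
      exact (h1.sub h2).hasDerivWithinAt
    · intro s hs
      rw [interior_Ici] at hs
      have := h s (mem_Ioi.mp hs).le
      show 0 ≤ deriv V s - c
      linarith
  set M := |V r| + 1 with hM
  have hM0 : 0 < M := by positivity
  have hMV : 0 ≤ M - V r := by
    have := le_abs_self (V r)
    linarith
  have hev : ∀ᶠ s in atTop, V s < M := hV.tendsto_zero (Iio_mem_nhds hM0)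
  obtain ⟨s, hs1, hs2⟩ := (hev.and (eventually_ge_atTop (r + (M - V r) / c))).exists
  have hrs : r ≤ s := by
    have : 0 ≤ (M - V r) / c := div_nonneg hMV hc.le
    linarith
  have hm := hmono self_mem_Ici (mem_Ici.mpr hrs) hrs
  simp only at hm
  have hcs : M - V r ≤ c * (s - r) := by
    have h1 := mul_le_mul_of_nonneg_left hs2 hc.le
    have h2 : c * (r + (M - V r) / c) = c * r + (M - V r) := by field_simp
    linarith
  have hs1' : V s < M := hs1
  linarith

/-- **Step A** (tail; the mechanism of the printed Lemma 2.5 (iii), in crude form): if `V''`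
exists on `(√(7/2), ∞)`, then (2.8) and `V → 0` give `V'(r) ≤ (α/2) r⁻²` for
`r ≥ √(7/2)` — `V' - (α/2) r⁻²` is non-decreasing (its derivative is
`V'' + α r⁻³ ≥ V'' + α r⁻¹⁰ ≥ 0`) and can never become positive.
[cite: FlatleyTheil2015, Lemma 2.5 and Definition 2.1 (2.8)] -/
theorem deriv_le_of_isLocalizedPair (hα : 0 ≤ α) (hV : IsLocalizedPair α V)
    (hd : DifferentiableOn ℝ (deriv V) (Ioi (√(7 / 2)))) {r : ℝ} (hr : √(7 / 2) ≤ r) :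
    deriv V r ≤ α / 2 * r ^ (-2 : ℤ) := by
  have ha : (5 / 4 : ℝ) ≤ √(7 / 2) := five_fourths_le_sqrt_seven_halves
  have hr0 : 0 < r := by linarith
  -- `h := V' - (α/2) r⁻²` is monotone on `[√(7/2), ∞)`
  have hmono : MonotoneOn (fun s => deriv V s - α / 2 * s ^ (-2 : ℤ)) (Ici (√(7 / 2))) := by
    refine monotoneOn_of_hasDerivWithinAt_nonneg (convex_Ici _)
      (f' := fun s => deriv (deriv V) s + α * s ^ (-3 : ℤ)) ?_ ?_ ?_
    · refine ((continuousOn_deriv_of_isLocalizedPair hV).mono fun s hs => ?_).sub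
        (continuousOn_const.mul ((continuousOn_zpow₀ (-2 : ℤ)).mono fun s hs => ?_))
      · exact lt_of_lt_of_le (by linarith) (mem_Ici.mp hs)
      · exact ne_of_gt (lt_of_lt_of_le (by linarith) (mem_Ici.mp hs))
    · intro s hs
      rw [interior_Ici] at hs ⊢
      have hs0 : 0 < s := by linarith [mem_Ioi.mp hs]
      have h1 : HasDerivAt (deriv V) (deriv (deriv V) s) s :=
        (hd.differentiableAt (Ioi_mem_nhds (mem_Ioi.mp hs))).hasDerivAt
      have h2 : HasDerivAt (fun x : ℝ => x ^ (-2 : ℤ)) ((-2 : ℝ) * s ^ (-3 : ℤ)) s :=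
        (hasDerivAt_zpow (-2 : ℤ) s (Or.inl hs0.ne')).congr_deriv (by norm_num)
      have h3 : HasDerivAt (fun y => deriv V y - α / 2 * y ^ (-2 : ℤ))
          (deriv (deriv V) s + α * s ^ (-3 : ℤ)) s :=
        (h1.sub (h2.const_mul (α / 2))).congr_deriv (by ring)
      exact h3.hasDerivWithinAt
    · intro s hs
      rw [interior_Ici] at hs
      have hs1 : 1 ≤ s := by linarith [mem_Ioi.mp hs]
      have hs0 : 0 < s := by linarith
      have hdec := hV.decay s (mem_Ioi.mp hs).le
      change |deriv (deriv V) s| ≤ α * s⁻¹ ^ 10 at hdec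
      have h10 : s⁻¹ ^ 10 ≤ s ^ (-3 : ℤ) := by
        rw [zpow_neg, zpow_ofNat, ← inv_pow]
        exact pow_le_pow_of_le_one (inv_nonneg.mpr hs0.le) (inv_le_one_of_one_le₀ hs1)
          (by norm_num)
      have h4 := (abs_le.mp hdec).1
      have h5 := mul_le_mul_of_nonneg_left h10 hα
      show 0 ≤ deriv (deriv V) s + α * s ^ (-3 : ℤ)
      linarith
  -- if `h r > 0`, then `V' ≥ h r > 0` on `[r, ∞)`, impossible
  by_contra hlt
  have hc : 0 < deriv V r - α / 2 * r ^ (-2 : ℤ) := by linarith [not_le.mp hlt]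
  refine false_of_le_deriv_of_isLocalizedPair hV hr0 hc fun s hs => ?_
  have hm := hmono (mem_Ici.mpr hr) (mem_Ici.mpr (hr.trans hs)) hs
  simp only at hm
  have : 0 ≤ α / 2 * s ^ (-2 : ℤ) := mul_nonneg (by linarith) (zpow_nonneg (by linarith) _)
  linarith

/-- **Step A, continued** (printed Lemma 2.5 (iii), crude form): `V(r) ≥ -(α/2) r⁻¹` for
`r ≥ √(7/2)` — `V + (α/2) r⁻¹` is non-increasing by `deriv_le_of_isLocalizedPair` and tends to
`0`. [cite: FlatleyTheil2015, Lemma 2.5 and Definition 2.1 (2.8)] -/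
theorem neg_le_of_isLocalizedPair (hα : 0 ≤ α) (hV : IsLocalizedPair α V)
    (hd : DifferentiableOn ℝ (deriv V) (Ioi (√(7 / 2)))) {r : ℝ} (hr : √(7 / 2) ≤ r) :
    -(α / 2 * r ^ (-1 : ℤ)) ≤ V r := by
  have ha : (5 / 4 : ℝ) ≤ √(7 / 2) := five_fourths_le_sqrt_seven_halves
  have hanti : AntitoneOn (fun s => V s + α / 2 * s ^ (-1 : ℤ)) (Ici (√(7 / 2))) := by
    refine antitoneOn_of_hasDerivWithinAt_nonpos (convex_Ici _)
      (f' := fun s => deriv V s - α / 2 * s ^ (-2 : ℤ)) ?_ ?_ ?_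
    · refine ((continuousOn_of_isLocalizedPair hV).mono fun s hs => ?_).add
        (continuousOn_const.mul ((continuousOn_zpow₀ (-1 : ℤ)).mono fun s hs => ?_))
      · exact lt_of_lt_of_le (by linarith) (mem_Ici.mp hs)
      · exact ne_of_gt (lt_of_lt_of_le (by linarith) (mem_Ici.mp hs))
    · intro s hs
      rw [interior_Ici] at hs ⊢
      have hs0 : 0 < s := by linarith [mem_Ioi.mp hs]
      have h1 : HasDerivAt V (deriv V s) s := hasDerivAt_of_isLocalizedPair hV hs0
      have h2 : HasDerivAt (fun x : ℝ => x ^ (-1 : ℤ)) ((-1 : ℝ) * s ^ (-2 : ℤ)) s :=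
        (hasDerivAt_zpow (-1 : ℤ) s (Or.inl hs0.ne')).congr_deriv (by norm_num)
      have h3 : HasDerivAt (fun y => V y + α / 2 * y ^ (-1 : ℤ))
          (deriv V s - α / 2 * s ^ (-2 : ℤ)) s :=
        (h1.add (h2.const_mul (α / 2))).congr_deriv (by ring)
      exact h3.hasDerivWithinAt
    · intro s hs
      rw [interior_Ici] at hs
      have := deriv_le_of_isLocalizedPair hα hV hd (mem_Ioi.mp hs).le
      show deriv V s - α / 2 * s ^ (-2 : ℤ) ≤ 0
      linarith
  have hlim : Tendsto (fun s => V s + α / 2 * s ^ (-1 : ℤ)) atTop (𝓝 0) := by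
    have h1 : Tendsto (fun s : ℝ => α / 2 * s ^ (-1 : ℤ)) atTop (𝓝 (α / 2 * 0)) := by
      simp only [zpow_neg, zpow_one]
      exact tendsto_inv_atTop_zero.const_mul _
    simpa using hV.tendsto_zero.add h1
  have hev : ∀ᶠ s in atTop, V s + α / 2 * s ^ (-1 : ℤ) ≤ V r + α / 2 * r ^ (-1 : ℤ) :=
    (eventually_ge_atTop r).mono fun s hs =>
      hanti (mem_Ici.mpr hr) (mem_Ici.mpr (hr.trans hs)) hs
  have := le_of_tendsto hlim hev
  linarith

/-- **Step B** (medium range; the mechanism of the printed Lemma 2.5 (i)–(ii)): if `V''`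
exists on `(1+α, √(7/2))`, then (2.7) gives `V'(1+α) ≤ V'(a) + α^{1/4} (a - 1 - α)` and
`V(1+α) ≥ V(a) - V'(a)(a - 1 - α) - α^{1/4} (a - 1 - α)²/2`, `a = √(7/2)`.
[cite: FlatleyTheil2015, Lemma 2.5 and Definition 2.1 (2.7)] -/
theorem medium_bounds_of_isLocalizedPair (hα : 0 < α) (hV : IsLocalizedPair α V)
    (hba : 1 + α ≤ √(7 / 2))
    (hd : DifferentiableOn ℝ (deriv V) (Ioo (1 + α) (√(7 / 2)))) :
    deriv V (1 + α) ≤ deriv V (√(7 / 2)) + α ^ (1 / 4 : ℝ) * (√(7 / 2) - (1 + α)) ∧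
    V (√(7 / 2)) - deriv V (√(7 / 2)) * (√(7 / 2) - (1 + α))
        - α ^ (1 / 4 : ℝ) * (√(7 / 2) - (1 + α)) ^ 2 / 2 ≤ V (1 + α) := by
  set a := √(7 / 2) with ha_def
  set β := α ^ (1 / 4 : ℝ) with hβ_def
  have hb0 : (0 : ℝ) < 1 + α := by linarith
  -- (2.7): `V''` exists and is `≥ -β` on `(1+α, a)`
  have hV'' : ∀ s ∈ Ioo (1 + α) a,
      HasDerivAt (deriv V) (deriv (deriv V) s) s ∧ -β ≤ deriv (deriv V) s := by
    intro s hs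
    refine ⟨(hd.differentiableAt (Ioo_mem_nhds hs.1 hs.2)).hasDerivAt, ?_⟩
    have h := hV.medium s ⟨hs.1.le, hs.2.le⟩
    change |deriv (deriv V) s| ≤ β at h
    exact (abs_le.mp h).1
  have hcontV' : ContinuousOn (deriv V) (Icc (1 + α) a) :=
    (continuousOn_deriv_of_isLocalizedPair hV).mono fun s hs => hb0.trans_le hs.1
  have hcontV : ContinuousOn V (Icc (1 + α) a) :=
    (continuousOn_of_isLocalizedPair hV).mono fun s hs => hb0.trans_le hs.1
  -- `V' + β r` is monotone on `[1+α, a]`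
  have hmono : MonotoneOn (fun s => deriv V s + β * s) (Icc (1 + α) a) := by
    refine monotoneOn_of_hasDerivWithinAt_nonneg (convex_Icc _ _)
      (f' := fun s => deriv (deriv V) s + β) (hcontV'.add (Continuous.continuousOn (by fun_prop)))
      ?_ ?_
    · intro s hs
      rw [interior_Icc] at hs ⊢
      have h2 : HasDerivAt (fun y : ℝ => β * y) β s := by
        simpa using (hasDerivAt_id s).const_mul β
      exact ((hV'' s hs).1.add h2).hasDerivWithinAt
    · intro s hs
      rw [interior_Icc] at hs
      have := (hV'' s hs).2
      show 0 ≤ deriv (deriv V) s + β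
      linarith
  have hslope : ∀ s ∈ Icc (1 + α) a, deriv V s ≤ deriv V a + β * (a - s) := by
    intro s hs
    have := hmono hs (right_mem_Icc.mpr hba) hs.2
    simp only at this
    linarith
  refine ⟨by have := hslope (1 + α) (left_mem_Icc.mpr hba); linarith, ?_⟩
  -- `V + V'(a) (a - r) + β (a - r)²/2` is antitone on `[1+α, a]`
  have hanti : AntitoneOn (fun s => V s + deriv V a * (a - s) + β * (a - s) ^ 2 / 2)
      (Icc (1 + α) a) := by
    refine antitoneOn_of_hasDerivWithinAt_nonpos (convex_Icc _ _)
      (f' := fun s => deriv V s - deriv V a - β * (a - s)) ?_ ?_ ?_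
    · exact (hcontV.add (Continuous.continuousOn (by fun_prop))).add
        (Continuous.continuousOn (by fun_prop))
    · intro s hs
      rw [interior_Icc] at hs ⊢
      have h1 := hasDerivAt_of_isLocalizedPair hV (hb0.trans hs.1)
      have hA : HasDerivAt (fun y : ℝ => a - y) (-1) s := (hasDerivAt_id' s).const_sub a
      have h : HasDerivAt (fun y => V y + deriv V a * (a - y) + β * (a - y) ^ 2 / 2)
          (deriv V s - deriv V a - β * (a - s)) s :=
        ((h1.add (hA.const_mul (deriv V a))).add
          (((hA.pow 2).const_mul β).div_const 2)).congr_deriv (by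
            simp only [Nat.cast_ofNat, Nat.reduceSub, pow_one]
            ring)
      exact h.hasDerivWithinAt
    · intro s hs
      rw [interior_Icc] at hs
      have := hslope s (Ioo_subset_Icc_self hs)
      show deriv V s - deriv V a - β * (a - s) ≤ 0
      linarith
  have := hanti (left_mem_Icc.mpr hba) (right_mem_Icc.mpr hba) hba
  simp only [sub_self, mul_zero, add_zero, ne_eq, OfNat.ofNat_ne_zero, not_false_eq_true,
    zero_pow, zero_div] at this
  linarith

/-- **Step C** (the well): by (2.5), `V'` exists and is non-decreasing on `[1, 1+α]`, so
`V(1+α) ≤ V(1) + α V'(1+α)`. [cite: FlatleyTheil2015, Definition 2.1 (2.5)] -/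
theorem well_bound_of_isLocalizedPair (hα : 0 < α) (hV : IsLocalizedPair α V) :
    V (1 + α) ≤ V 1 + α * deriv V (1 + α) := by
  have h1b : (1 : ℝ) ≤ 1 + α := by linarith
  -- (2.5): `V''` exists and is `≥ 1 ≥ 0` on `(1, 1+α) ⊆ (1-α, 1+α)`
  have hV'' : ∀ s ∈ Ioo 1 (1 + α),
      HasDerivAt (deriv V) (deriv (deriv V) s) s ∧ 0 ≤ deriv (deriv V) s := by
    intro s hs
    have h := hV.convex s ⟨by linarith [hs.1], hs.2⟩
    change 1 ≤ deriv (deriv V) s at h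
    have hd : DifferentiableAt ℝ (deriv V) s := by
      by_contra hnd
      rw [deriv_zero_of_not_differentiableAt hnd] at h
      norm_num at h
    exact ⟨hd.hasDerivAt, by linarith⟩
  have hcontV' : ContinuousOn (deriv V) (Icc 1 (1 + α)) :=
    (continuousOn_deriv_of_isLocalizedPair hV).mono fun s hs => one_pos.trans_le hs.1
  have hmono : MonotoneOn (deriv V) (Icc 1 (1 + α)) :=
    monotoneOn_of_hasDerivWithinAt_nonneg (convex_Icc _ _) (f' := fun s => deriv (deriv V) s)
      hcontV'
      (fun s hs => by rw [interior_Icc] at hs ⊢; exact (hV'' s hs).1.hasDerivWithinAt)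
      (fun s hs => by rw [interior_Icc] at hs; exact (hV'' s hs).2)
  -- `V - V'(1+α) r` is antitone on `[1, 1+α]`
  have hanti : AntitoneOn (fun s => V s - deriv V (1 + α) * s) (Icc 1 (1 + α)) := by
    refine antitoneOn_of_hasDerivWithinAt_nonpos (convex_Icc _ _)
      (f' := fun s => deriv V s - deriv V (1 + α)) ?_ ?_ ?_
    · exact ((continuousOn_of_isLocalizedPair hV).mono fun s hs => one_pos.trans_le hs.1).sub
        (Continuous.continuousOn (by fun_prop))
    · intro s hs
      rw [interior_Icc] at hs ⊢
      have h1 := hasDerivAt_of_isLocalizedPair hV (one_pos.trans hs.1)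
      have h2 : HasDerivAt (fun y : ℝ => deriv V (1 + α) * y) (deriv V (1 + α)) s := by
        simpa using (hasDerivAt_id s).const_mul (deriv V (1 + α))
      exact (h1.sub h2).hasDerivWithinAt
    · intro s hs
      rw [interior_Icc] at hs
      have := hmono (Ioo_subset_Icc_self hs) (right_mem_Icc.mpr h1b) hs.2.le
      show deriv V s - deriv V (1 + α) ≤ 0
      linarith
  have := hanti (left_mem_Icc.mpr h1b) (right_mem_Icc.mpr h1b) h1b
  simp only at this
  have key : deriv V (1 + α) * (1 + α) - deriv V (1 + α) * 1 = α * deriv V (1 + α) := by ring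
  linarith

/-- **Item 1 of Definition 2.1 of Flatley–Theil is inconsistent as printed, for every
`α ∈ (0, 1/4]`**: no `V ∈ C¹([0,∞))` with `V → 0`, `V(1) = -1`, (2.5), (2.7), (2.8) has `V'`
differentiable on `(1+α, √(7/2))` and `(√(7/2), ∞)` (as writing `V''` there presupposes).
Proof: Steps A–C above give `-α/2 - α/7 - α^{1/4}/2 ≤ V(1+α) ≤ -1 + α²/7 + α·α^{1/4}`, i.e.
`1 ≤ 19α/28 + (3/4)α^{1/4} < 1`. Consequently `Y_α = ∅` for `α ≤ 1/4` and Theorem 1.1 as printed is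
vacuous (`FlatleyTheil2015_thm11_printed`). Only the fields `contDiffOn`, `tendsto_zero`,
`apply_one`, `convex`, `medium`, `decay` of `IsLocalizedPair` are used.
[cite: FlatleyTheil2015, Definition 2.1 (2.5), (2.7), (2.8) (arXiv v1 p. 8) and Lemma 2.5 (p. 10)] -/
theorem not_isLocalizedPair_of_differentiableOn (hα : 0 < α) (hα4 : α ≤ 1 / 4)
    (hd1 : DifferentiableOn ℝ (deriv V) (Ioo (1 + α) (√(7 / 2))))
    (hd2 : DifferentiableOn ℝ (deriv V) (Ioi (√(7 / 2)))) : ¬ IsLocalizedPair α V := by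
  intro hV
  have ha54 : (5 / 4 : ℝ) ≤ √(7 / 2) := five_fourths_le_sqrt_seven_halves
  have ha2 : √(7 / 2) ≤ (2 : ℝ) := sqrt_seven_halves_le_two
  have hasq : √(7 / 2 : ℝ) ^ 2 = 7 / 2 := Real.sq_sqrt (by norm_num)
  set a := √(7 / 2) with ha_def
  set β := α ^ (1 / 4 : ℝ) with hβ_def
  have hβ0 : 0 ≤ β := Real.rpow_nonneg hα.le _
  have hβ1 : β ≤ 1 := Real.rpow_le_one hα.le (by linarith) (by norm_num)
  have hba : 1 + α ≤ a := by linarith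
  have hL0 : 0 ≤ a - (1 + α) := by linarith
  have hL1 : a - (1 + α) ≤ 1 := by linarith
  -- Step A at `a = √(7/2)`: `V'(a) ≤ α/7`, `V(a) ≥ -α/2`
  have hA1 : deriv V a ≤ α / 7 := by
    have h := deriv_le_of_isLocalizedPair hα.le hV hd2 le_rfl
    have h2 : a ^ (-2 : ℤ) = 2 / 7 := by
      rw [zpow_neg, zpow_ofNat, hasq]; norm_num
    rw [h2] at h
    linarith
  have hA2 : -(α / 2) ≤ V a := by
    have h := neg_le_of_isLocalizedPair hα.le hV hd2 le_rfl
    have h1 : a ^ (-1 : ℤ) ≤ 1 := by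
      rw [zpow_neg, zpow_one]
      exact inv_le_one_of_one_le₀ (by linarith)
    have h2 := mul_le_mul_of_nonneg_left h1 (by linarith : 0 ≤ α / 2)
    linarith
  -- Step B on `[1+α, a]`, Step C on `[1, 1+α]`
  obtain ⟨hB1, hB2⟩ := medium_bounds_of_isLocalizedPair hα hV hba hd1
  have hC := well_bound_of_isLocalizedPair hα hV
  rw [hV.apply_one] at hC
  -- arithmetic
  have h1 : β * (a - (1 + α)) ≤ β := by nlinarith
  have h2 : deriv V (1 + α) ≤ α / 7 + β := by linarith
  have h3 : α * deriv V (1 + α) ≤ α * (α / 7 + β) := mul_le_mul_of_nonneg_left h2 hα.le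
  have h4 : deriv V a * (a - (1 + α)) ≤ α / 7 := by
    rcases le_or_gt 0 (deriv V a) with hpos | hneg
    · nlinarith
    · nlinarith
  have h5 : β * (a - (1 + α)) ^ 2 / 2 ≤ β / 2 := by nlinarith
  have h6 : α * β ≤ β / 4 := by nlinarith
  have h7 : α * (α / 7) ≤ 1 / 100 := by nlinarith
  linarith

/-- **Flatley–Theil 2015, Theorem 1.1, as printed — i.e. the statement of `FlatleyTheil2015_thm11`
with the two hypotheses the transcription `IsLocalizedPair` drops: `V''` exists on the interiors
`(1+α, √(7/2))` and `(√(7/2), ∞)` of the ranges of (2.7) and (2.8)** (conditions on `V''(r)`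
presuppose that `V'` is differentiable at `r`; on the range of (2.5) this is automatic from
`1 ≤ deriv^[2] V r`). Otherwise verbatim the statement of `FlatleyTheil2015_thm11`: there is
`α₀ > 0` such that for `α ∈ (0, α₀)` and every such `α`-localized `(V, Ψ)` with
permutation-invariant three-body term, (i) `∃ r > 0, E_fcc(r) < E(Y)/#Y` for every non-empty finite
`Y ⊂ ℝ³`, and (ii) for every `ε > 0` and all large `R`, `Y_R = B(0,R) ∩ L_fcc` is non-empty with
`E(Y_R)/#Y_R < E_fcc(r) + ε` for all `r > 0`.
DISCREPANCY RECORD (why this declaration exists): see the section docstring above —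
`FlatleyTheil2015_thm11` quantifies over a strictly larger class than the paper's `Y_α` (no
existence of `V''` in (2.7)–(2.8)) and is therefore not the printed theorem; and the printed class
is EMPTY for `α ≤ 1/4` (`not_isLocalizedPair_of_differentiableOn`), so the printed theorem is
proved here VACUOUSLY, with `α₀ = 1/4`. It is a theorem, not a registered fact, precisely so that
nobody cites it as a usable crystallization result: its hypotheses cannot be met.
[cite: FlatleyTheil2015, Thm 1.1 (arXiv v1 p. 3) with §2 eq. (2.1) and Definition 2.1 (p. 8)] -/
theorem FlatleyTheil2015_thm11_printed :
    ∃ α₀ : ℝ, 0 < α₀ ∧ ∀ α : ℝ, 0 < α → α < α₀ →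
      ∀ (V : ℝ → ℝ) (Ψ : (Fin 3 → ℝ) → ℝ), IsLocalizedPair α V →
        DifferentiableOn ℝ (deriv V) (Set.Ioo (1 + α) (√(7 / 2))) →
        DifferentiableOn ℝ (deriv V) (Set.Ioi (√(7 / 2))) →
        IsLocalizedTriple α Ψ →
        (∀ (y : Fin 3 → Space) (σ : Equiv.Perm (Fin 3)),
            Ψ (sideLengths (y (σ 0)) (y (σ 1)) (y (σ 2))) = Ψ (sideLengths (y 0) (y 1) (y 2))) →
        (∀ Y : Finset Space, Y.Nonempty →
            ∃ r : ℝ, 0 < r ∧ fccEnergy V Ψ r < configEnergy V Ψ Y / Y.card) ∧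
        (∀ ε : ℝ, 0 < ε → ∃ R₀ : ℝ, ∀ R : ℝ, R₀ ≤ R → ∀ Y : Finset Space,
            (↑Y : Set Space) = Metric.ball (0 : Space) R ∩ fccLattice →
              Y.Nonempty ∧ ∀ r : ℝ, 0 < r → configEnergy V Ψ Y / Y.card < fccEnergy V Ψ r + ε) :=
  ⟨1 / 4, by norm_num, fun _α hα hα4 _V _Ψ hV hd1 hd2 _ _ =>
    absurd hV (not_isLocalizedPair_of_differentiableOn hα hα4.le hd1 hd2)⟩

end PrintedClassEmpty

end Literature.MathematicalPhysics.StatisticalMechanics.FlatleyTheil2015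

end
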